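import Literature.Geometry.Riemannian.ThreeShrinkerDegenerateScalarBound
import Literature.Geometry.Riemannian.GeodesicChartBridge
import Literature.Geometry.Riemannian.BonnetMyers
import Literature.Geometry.Riemannian.ThreeShrinkerFlatCase
import Literature.Geometry.Riemannian.ExpMapGlobalSmooth
import Literature.Geometry.Lorentzian.CurvatureRegularity
import Literature.Geometry.Riemannian.EllipticMaximumPrincipleClosed
import HarnessLib

/-!
# Degenerate three-dimensional shrinkers: conservation laws along geodesics and the critical level

The degenerate case of the classification of complete three-dimensional gradient shrinking Ricci
solitons (`threeShrinkerClassification_modelData`; Munteanu–Wang 2016, Thm. 1.2, model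
`S² × ℝ` and its quotients): a connected complete three-dimensional gradient soliton
`Ric + Hess f = λ g` with `Ric ≥ 0`, `S > 0` and a null vector of `Ric` somewhere. Locally
(`ThreeShrinkerDegenerateLocalStructure`) there is a parallel unit null field `v` with
`Ric = (S/2)(g − θ ⊗ θ)`, `θ = g(v, ·)`; globally `v` is only defined up to sign, but the
quantities

* `h = |∇f|² − (2/S) Ric(∇f, ∇f)` (`= df(v)²`),
* `κ(w) = g(w, w) − (2/S) Ric(w, w)` (`= θ(w)²`),
* `σ(w) = df(w) − (2/S) Ric(∇f, w)` (`= df(v) θ(w)`)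

are global, and this file proves their behaviour along the geodesics `γ` of `g` (read in charts
through `GeodesicChartBridge` and `CoordNullLeafCalculus`):

* `κ(γ̇)` is constant (`θ(γ̇)` is: `v` is parallel); `h ∘ γ` is the quadratic
  `h(p) + 2λ σ₀ t + λ² κ₀ t²` (`d(df(v)) = λ θ`); `σ² = h κ` pointwise;
* along a null geodesic (`γ̇(0)` a unit null vector) `S` is constant and `h` has a zero; hence the
  critical level `Σ₀ = {h = 0}` is non-empty and `S(M) = S(Σ₀)`;
* two points of `Σ₀` are joined (Hopf–Rinow) by a minimising geodesic with `κ ≡ 0`, along which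
  `Ric(γ̇, γ̇) = S/2 ≥ C/2` (`ThreeShrinkerDegenerateScalarBound`), so by the second-variation
  (Myers) estimate `d ≤ 2π/√C`: `Σ₀` is compact;
* consequently `S` attains its infimum and its supremum over `M` at points of `Σ₀`, and such
  points are critical points of `f` with `f = S` there (normalised shrinker).

This is the "compact leaf" half of the proof that a degenerate shrinker is a quotient of the round
cylinder, carried out inside `M` (no leaf space is formed). Everything is proved; no definitions
are introduced (the functions `h, κ, σ, ∇f` enter as variables constrained by their defining
equations).

## References

* O. Munteanu, J. Wang, arXiv:1606.01861, Thm. 1.2 (p. 3). [MunteanuWang2016]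
* P. Petersen, W. Wylie, Geom. Topol. 14 (2010), §3. [PetersenWylie2010]
* R. S. Hamilton, *The Ricci flow on surfaces*, Contemp. Math. 71 (1988), §10. [Hamilton1988]
* S. B. Myers, Duke Math. J. 8 (1941), 401–404, Thm. 1. [Myers1941]
* B. O'Neill, *Semi-Riemannian geometry*, 1983, Ch. 3, Prop. 3.59; Ch. 10, Thm. 10.22. [ONeill1983]
-/

noncomputable section

set_option maxSynthPendingDepth 3

open Bundle Set Function Filter Module Metric
open scoped Manifold ContDiff Topology NNReal

namespace Literature.Geometry.Riemannian

open Lorentzian Lorentzian.PseudoRiemannianMetric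

variable {M : Type*} [TopologicalSpace M] [ChartedSpace (EuclideanSpace ℝ (Fin 3)) M]
  [IsManifold (𝓡 3) ∞ M]
  (g : PseudoRiemannianMetric (𝓡 3) ∞ (EuclideanSpace ℝ (Fin 3)) (TangentSpace (𝓡 3) : M → Type _))
  [g.HasLeviCivita]

namespace DegenerateShrinker

/-! ### The local chart data of a degenerate soliton -/

/-- **The chart data at a point of a degenerate soliton.** In the chart at `x₀`
(`G = chartRep`, `f̂ = f ∘ φ⁻¹`): an open `U ∋ φ x₀` inside the chart target carrying a smooth
unit null field `v`, parallel (`Dv = −Γ(·, v)`), with `Ric = (S/2)(G − θ ⊗ θ)` on `U`, together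
with the chart form of the soliton equation and `S > 0` on the target.
[cite: PetersenWylie2010, §3] [cite: MunteanuWang2016, Thm. 1.2] -/
theorem exists_chart_data [ConnectedSpace M] (hg : g.IsRiemannian)
    {f : M → ℝ} (hf : ContMDiff (𝓡 3) 𝓘(ℝ, ℝ) ∞ f) {lam : ℝ}
    (hsol : ∀ (x : M) (X Y : TangentSpace (𝓡 3) x),
      g.ricci x X Y + g.hessian f x X Y = lam * g.val x X Y)
    (hRic0 : ∀ (x : M) (w : TangentSpace (𝓡 3) x), 0 ≤ g.ricci x w w)
    (hS : ∀ x, 0 < g.scalarCurvature x) {p : M} {w₀ : TangentSpace (𝓡 3) p} (hw₀ : w₀ ≠ 0)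
    (hnull : g.ricci p w₀ w₀ = 0) (x₀ : M) :
    MetricCoord.IsMetricOn (chartRep (𝓡 3) (fun _ ↦ g) x₀ 0) (extChartAt (𝓡 3) x₀).target ∧
    (∀ y ∈ (extChartAt (𝓡 3) x₀).target, ∀ a : EuclideanSpace ℝ (Fin 3), a ≠ 0 →
      0 < chartRep (𝓡 3) (fun _ ↦ g) x₀ 0 y a a) ∧
    ContDiffOn ℝ ∞ (f ∘ (extChartAt (𝓡 3) x₀).symm) (extChartAt (𝓡 3) x₀).target ∧
    (∀ y ∈ (extChartAt (𝓡 3) x₀).target, ∀ a b,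
      MetricCoord.ricAt (chartRep (𝓡 3) (fun _ ↦ g) x₀ 0) y a b +
        MetricCoord.hessAt (chartRep (𝓡 3) (fun _ ↦ g) x₀ 0) (f ∘ (extChartAt (𝓡 3) x₀).symm)
          y a b = lam * chartRep (𝓡 3) (fun _ ↦ g) x₀ 0 y a b) ∧
    (∀ y ∈ (extChartAt (𝓡 3) x₀).target,
      0 < MetricCoord.scalAt (chartRep (𝓡 3) (fun _ ↦ g) x₀ 0) y) ∧
    ∃ U : Set (EuclideanSpace ℝ (Fin 3)), IsOpen U ∧ extChartAt (𝓡 3) x₀ x₀ ∈ U ∧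
      U ⊆ (extChartAt (𝓡 3) x₀).target ∧
      ∃ v : EuclideanSpace ℝ (Fin 3) → EuclideanSpace ℝ (Fin 3), ContDiffOn ℝ ∞ v U ∧
        (∀ z ∈ U, ∀ X, fderiv ℝ v z X +
          MetricCoord.chrAt (chartRep (𝓡 3) (fun _ ↦ g) x₀ 0) z X (v z) = 0) ∧
        (∀ z ∈ U, chartRep (𝓡 3) (fun _ ↦ g) x₀ 0 z (v z) (v z) = 1) ∧
        (∀ z ∈ U, ∀ Z, MetricCoord.ricAt (chartRep (𝓡 3) (fun _ ↦ g) x₀ 0) z (v z) Z = 0) ∧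
        (∀ z ∈ U, ∀ W Z, MetricCoord.ricAt (chartRep (𝓡 3) (fun _ ↦ g) x₀ 0) z W Z =
          MetricCoord.scalAt (chartRep (𝓡 3) (fun _ ↦ g) x₀ 0) z / 2 *
            (chartRep (𝓡 3) (fun _ ↦ g) x₀ 0 z W Z - chartRep (𝓡 3) (fun _ ↦ g) x₀ 0 z (v z) W *
              chartRep (𝓡 3) (fun _ ↦ g) x₀ 0 z (v z) Z)) ∧
        (∀ z ∈ U, ∀ W, MetricCoord.riemAt (chartRep (𝓡 3) (fun _ ↦ g) x₀ 0) z W (v z) = 0) := by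
  have h3 : finrank ℝ (EuclideanSpace ℝ (Fin 3)) = 3 := finrank_euclideanSpace_fin
  set G := chartRep (𝓡 3) (fun _ ↦ g) x₀ 0 with hGdef
  set T : Set (EuclideanSpace ℝ (Fin 3)) := (extChartAt (𝓡 3) x₀).target with hT
  have hGm : MetricCoord.IsMetricOn G T :=
    Lorentzian.OpensChart.isMetricOn_repr (val_chartPullback_eq_chartRep (fun _ : ℝ ↦ g) x₀ 0)
  have hGpos : ∀ y ∈ T, ∀ v : EuclideanSpace ℝ (Fin 3), v ≠ 0 → 0 < G y v v := by
    intro y hy v hv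
    rw [hGdef, show y = ((⟨y, hy⟩ : chartTarget (𝓡 3) x₀) : EuclideanSpace ℝ (Fin 3)) from rfl,
      chartRep_apply]
    exact chartPullback_pos g x₀ ⟨y, hy⟩ (fun w hw ↦ hg _ w hw) v hv
  set fc : EuclideanSpace ℝ (Fin 3) → ℝ := f ∘ (extChartAt (𝓡 3) x₀).symm with hfc
  have hfcs : ContDiffOn ℝ ∞ fc T := by
    rw [hfc, ← contMDiffOn_iff_contDiffOn]
    exact hf.comp_contMDiffOn (contMDiffOn_extChartAt_symm x₀)
  have hsolc := soliton_chartRep_target g x₀ hf hsol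
  have hScal : ∀ y (hy : y ∈ T),
      MetricCoord.scalAt G y = g.scalarCurvature (chartInv (𝓡 3) x₀ ⟨y, hy⟩) := fun y hy ↦
    (Lorentzian.scalarCurvature_chartInv_eq g x₀ ⟨y, hy⟩).symm
  have hSpos : ∀ y ∈ T, 0 < MetricCoord.scalAt G y := fun y hy ↦ by rw [hScal y hy]; exact hS _
  have hRicc : ∀ y ∈ T, ∀ w : EuclideanSpace ℝ (Fin 3), 0 ≤ MetricCoord.ricAt G y w w := by
    intro y hy w
    have h := hRic0 (chartInv (𝓡 3) x₀ ⟨y, hy⟩)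
      (mfderiv 𝓘(ℝ, EuclideanSpace ℝ (Fin 3)) (𝓡 3) (chartInv (𝓡 3) x₀) ⟨y, hy⟩ w)
    rwa [ricci_chartInv_mfderiv_eq_ricAt] at h
  obtain ⟨U, hUo, hu₀U, hUT, v, hvs, hvU, hpar⟩ :=
    exists_parallel_null_field_chart_of_soliton g hg hf hsol hRic0 hS hw₀ hnull x₀
  have hGU : MetricCoord.IsMetricOn G U := hGm.mono hUo hUT
  have hboth : ∀ z ∈ U, (∀ W Z, MetricCoord.ricAt G z W Z =
      MetricCoord.scalAt G z / 2 * (G z W Z - G z (v z) W * G z (v z) Z)) ∧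
      ∀ W, MetricCoord.riemAt G z W (v z) = 0 := by
    intro z hz
    have hzT := hUT hz
    have hvz : v z ≠ 0 := by
      intro h0
      have h1 := (hvU z hz).1
      rw [h0] at h1
      simp at h1
    obtain ⟨e, a, ha, he, hμ⟩ := hGm.exists_null_eigenframe_of_null hzT h3 hGpos hfcs hsolc hRicc
      (hSpos z hzT) hvz ((hvU z hz).2 (v z))
    exact ⟨fun W Z ↦ hGU.ricAt_eq_of_unit_null e he ha hμ (hvU z hz).1 (hvU z hz).2 hz W Z,
      fun W ↦ hGU.riemAt_unit_null_eq_zero e he ha hμ (hvU z hz).1 (hvU z hz).2 hz W⟩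
  exact ⟨hGm, hGpos, hfcs, hsolc, hSpos, U, hUo, hu₀U, hUT, v, hvs, hpar, fun z hz ↦ (hvU z hz).1,
    fun z hz ↦ (hvU z hz).2, fun z hz ↦ (hboth z hz).1, fun z hz ↦ (hboth z hz).2⟩

/-! ### The dictionary between `M` and the chart -/

omit [g.HasLeviCivita] in
/-- A point of the chart source and a tangent vector there, written through `chartInv` and its
differential: `x = Φ(φ x)`, `w = dΦ_{φ x}(dφ_x w)`. [folklore] -/
theorem eq_chartInv_and_eq_mfderiv (x₁ : M) {x : M} (hx : x ∈ (extChartAt (𝓡 3) x₁).source)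
    (w : TangentSpace (𝓡 3) x) :
    chartInv (𝓡 3) x₁ ⟨extChartAt (𝓡 3) x₁ x, (extChartAt (𝓡 3) x₁).map_source hx⟩ = x ∧
    mfderiv 𝓘(ℝ, EuclideanSpace ℝ (Fin 3)) (𝓡 3) (chartInv (𝓡 3) x₁)
        ⟨extChartAt (𝓡 3) x₁ x, (extChartAt (𝓡 3) x₁).map_source hx⟩
      (mfderiv (𝓡 3) (𝓡 3) (extChartAt (𝓡 3) x₁) x w) = w :=
  ⟨(extChartAt (𝓡 3) x₁).left_inv hx, mfderiv_chartInv_mfderiv_extChartAt x₁ hx w⟩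

/-- **The dictionary.** For `u` in the chart target and `a, b ∈ ℝ³`, at `x = Φ u` with
`A = dΦ a`, `B = dΦ b`: `g(A, B) = G(a, b)`, `Ric(A, B) = Ric_G(a, b)`, `S = scalAt G`,
`df(A) = Df̂(a)`, `∇f = dΦ(♯ Df̂)`, `|∇f|² = gradSqAt G f̂`, `f = f̂`.
[cite: ONeill1983, Ch. 3, Prop. 3.59] -/
theorem dictionary (x₁ : M) (u : chartTarget (𝓡 3) x₁) {f : M → ℝ}
    (hf : ContMDiff (𝓡 3) 𝓘(ℝ, ℝ) ∞ f) (a b : EuclideanSpace ℝ (Fin 3)) :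
    g.val (chartInv (𝓡 3) x₁ u)
        (mfderiv 𝓘(ℝ, EuclideanSpace ℝ (Fin 3)) (𝓡 3) (chartInv (𝓡 3) x₁) u a)
        (mfderiv 𝓘(ℝ, EuclideanSpace ℝ (Fin 3)) (𝓡 3) (chartInv (𝓡 3) x₁) u b) =
      chartRep (𝓡 3) (fun _ ↦ g) x₁ 0 u a b ∧
    g.ricci (chartInv (𝓡 3) x₁ u)
        (mfderiv 𝓘(ℝ, EuclideanSpace ℝ (Fin 3)) (𝓡 3) (chartInv (𝓡 3) x₁) u a)
        (mfderiv 𝓘(ℝ, EuclideanSpace ℝ (Fin 3)) (𝓡 3) (chartInv (𝓡 3) x₁) u b) =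
      MetricCoord.ricAt (chartRep (𝓡 3) (fun _ ↦ g) x₁ 0) u a b ∧
    g.scalarCurvature (chartInv (𝓡 3) x₁ u) =
      MetricCoord.scalAt (chartRep (𝓡 3) (fun _ ↦ g) x₁ 0) u ∧
    mvfderiv (𝓡 3) f (chartInv (𝓡 3) x₁ u)
        (mfderiv 𝓘(ℝ, EuclideanSpace ℝ (Fin 3)) (𝓡 3) (chartInv (𝓡 3) x₁) u a) =
      fderiv ℝ (f ∘ (extChartAt (𝓡 3) x₁).symm) u a ∧
    g.sharp (chartInv (𝓡 3) x₁ u) (mvfderiv (𝓡 3) f (chartInv (𝓡 3) x₁ u) :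
        TangentSpace (𝓡 3) (chartInv (𝓡 3) x₁ u) →ₗ[ℝ] ℝ) =
      mfderiv 𝓘(ℝ, EuclideanSpace ℝ (Fin 3)) (𝓡 3) (chartInv (𝓡 3) x₁) u
        (MetricCoord.sharpAt (chartRep (𝓡 3) (fun _ ↦ g) x₁ 0) u
          (fderiv ℝ (f ∘ (extChartAt (𝓡 3) x₁).symm) u)) ∧
    g.gradSq f (chartInv (𝓡 3) x₁ u) =
      MetricCoord.gradSqAt (chartRep (𝓡 3) (fun _ ↦ g) x₁ 0) (f ∘ (extChartAt (𝓡 3) x₁).symm) u ∧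
    f (chartInv (𝓡 3) x₁ u) = (f ∘ (extChartAt (𝓡 3) x₁).symm) u := by
  have hfd : MDifferentiableAt (𝓡 3) 𝓘(ℝ, ℝ) f (chartInv (𝓡 3) x₁ u) :=
    hf.mdifferentiableAt (by simp)
  exact ⟨val_chartInv_mfderiv_eq_chartRep g x₁ u a b, ricci_chartInv_mfderiv_eq_ricAt g x₁ u a b,
    Lorentzian.scalarCurvature_chartInv_eq g x₁ u, mvfderiv_chartInv_apply_eq_fderiv x₁ u hfd a,
    (mfderiv_chartInv_sharpAt_eq g x₁ u hfd).symm, gradSq_chartInv_eq g x₁ u hfd, rfl⟩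


/-- The dictionary in the chart direction: for `x` in the chart source and `w, w' ∈ T_x M`, with
`u = φ x`, `a = dφ w`, `a' = dφ w'`. [cite: ONeill1983, Ch. 3, Prop. 3.59] -/
theorem dictionary_source (x₁ : M) {x : M} (hx : x ∈ (extChartAt (𝓡 3) x₁).source) {f : M → ℝ}
    (hf : ContMDiff (𝓡 3) 𝓘(ℝ, ℝ) ∞ f) (w w' : TangentSpace (𝓡 3) x) :
    g.val x w w' = chartRep (𝓡 3) (fun _ ↦ g) x₁ 0 (extChartAt (𝓡 3) x₁ x)
      (mfderiv (𝓡 3) (𝓡 3) (extChartAt (𝓡 3) x₁) x w)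
      (mfderiv (𝓡 3) (𝓡 3) (extChartAt (𝓡 3) x₁) x w') ∧
    g.ricci x w w' = MetricCoord.ricAt (chartRep (𝓡 3) (fun _ ↦ g) x₁ 0) (extChartAt (𝓡 3) x₁ x)
      (mfderiv (𝓡 3) (𝓡 3) (extChartAt (𝓡 3) x₁) x w)
      (mfderiv (𝓡 3) (𝓡 3) (extChartAt (𝓡 3) x₁) x w') ∧
    g.scalarCurvature x =
      MetricCoord.scalAt (chartRep (𝓡 3) (fun _ ↦ g) x₁ 0) (extChartAt (𝓡 3) x₁ x) ∧
    mvfderiv (𝓡 3) f x w =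
      fderiv ℝ (f ∘ (extChartAt (𝓡 3) x₁).symm) (extChartAt (𝓡 3) x₁ x)
        (mfderiv (𝓡 3) (𝓡 3) (extChartAt (𝓡 3) x₁) x w) ∧
    g.ricci x (g.sharp x (mvfderiv (𝓡 3) f x : TangentSpace (𝓡 3) x →ₗ[ℝ] ℝ)) w' =
      MetricCoord.ricAt (chartRep (𝓡 3) (fun _ ↦ g) x₁ 0) (extChartAt (𝓡 3) x₁ x)
        (MetricCoord.sharpAt (chartRep (𝓡 3) (fun _ ↦ g) x₁ 0) (extChartAt (𝓡 3) x₁ x)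
          (fderiv ℝ (f ∘ (extChartAt (𝓡 3) x₁).symm) (extChartAt (𝓡 3) x₁ x)))
        (mfderiv (𝓡 3) (𝓡 3) (extChartAt (𝓡 3) x₁) x w') ∧
    g.ricci x (g.sharp x (mvfderiv (𝓡 3) f x : TangentSpace (𝓡 3) x →ₗ[ℝ] ℝ))
        (g.sharp x (mvfderiv (𝓡 3) f x : TangentSpace (𝓡 3) x →ₗ[ℝ] ℝ)) =
      MetricCoord.ricAt (chartRep (𝓡 3) (fun _ ↦ g) x₁ 0) (extChartAt (𝓡 3) x₁ x)
        (MetricCoord.sharpAt (chartRep (𝓡 3) (fun _ ↦ g) x₁ 0) (extChartAt (𝓡 3) x₁ x)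
          (fderiv ℝ (f ∘ (extChartAt (𝓡 3) x₁).symm) (extChartAt (𝓡 3) x₁ x)))
        (MetricCoord.sharpAt (chartRep (𝓡 3) (fun _ ↦ g) x₁ 0) (extChartAt (𝓡 3) x₁ x)
          (fderiv ℝ (f ∘ (extChartAt (𝓡 3) x₁).symm) (extChartAt (𝓡 3) x₁ x))) ∧
    g.gradSq f x = MetricCoord.gradSqAt (chartRep (𝓡 3) (fun _ ↦ g) x₁ 0)
      (f ∘ (extChartAt (𝓡 3) x₁).symm) (extChartAt (𝓡 3) x₁ x) ∧
    f x = (f ∘ (extChartAt (𝓡 3) x₁).symm) (extChartAt (𝓡 3) x₁ x) := by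
  set u : chartTarget (𝓡 3) x₁ := ⟨extChartAt (𝓡 3) x₁ x, (extChartAt (𝓡 3) x₁).map_source hx⟩
    with hu
  have h1 : chartInv (𝓡 3) x₁ u = x := (extChartAt (𝓡 3) x₁).left_inv hx
  have hw : mfderiv 𝓘(ℝ, EuclideanSpace ℝ (Fin 3)) (𝓡 3) (chartInv (𝓡 3) x₁) u
      (mfderiv (𝓡 3) (𝓡 3) (extChartAt (𝓡 3) x₁) x w) = w :=
    mfderiv_chartInv_mfderiv_extChartAt x₁ hx w
  have hw' : mfderiv 𝓘(ℝ, EuclideanSpace ℝ (Fin 3)) (𝓡 3) (chartInv (𝓡 3) x₁) u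
      (mfderiv (𝓡 3) (𝓡 3) (extChartAt (𝓡 3) x₁) x w') = w' :=
    mfderiv_chartInv_mfderiv_extChartAt x₁ hx w'
  obtain ⟨d1, d2, d3, d4, d5, d6, d7⟩ := dictionary g x₁ u hf
    (mfderiv (𝓡 3) (𝓡 3) (extChartAt (𝓡 3) x₁) x w) (mfderiv (𝓡 3) (𝓡 3) (extChartAt (𝓡 3) x₁) x w')
  -- `Ric(∇f, w')` and `Ric(∇f, ∇f)`
  have d8 := ricci_chartInv_mfderiv_eq_ricAt g x₁ u
    (MetricCoord.sharpAt (chartRep (𝓡 3) (fun _ ↦ g) x₁ 0) u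
      (fderiv ℝ (f ∘ (extChartAt (𝓡 3) x₁).symm) u))
    (mfderiv (𝓡 3) (𝓡 3) (extChartAt (𝓡 3) x₁) x w')
  have d9 := ricci_chartInv_mfderiv_eq_ricAt g x₁ u
    (MetricCoord.sharpAt (chartRep (𝓡 3) (fun _ ↦ g) x₁ 0) u
      (fderiv ℝ (f ∘ (extChartAt (𝓡 3) x₁).symm) u))
    (MetricCoord.sharpAt (chartRep (𝓡 3) (fun _ ↦ g) x₁ 0) u
      (fderiv ℝ (f ∘ (extChartAt (𝓡 3) x₁).symm) u))
  rw [← d5] at d8 d9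
  rw [hw, hw'] at d1 d2
  rw [hw] at d4
  rw [hw'] at d8
  rw [h1] at d1 d2 d3 d4 d6 d7 d8 d9
  exact ⟨d1, d2, d3, d4, d8, d9, d6, d7⟩

/-! ### Linear algebra: the equality case `G(a, a) = G(v, a)²` for a unit vector `v` -/

/-- For a positive definite symmetric form, a unit vector `v` and a vector `a` with
`G(a, a) = G(v, a)²`: `a = G(v, a) v` (`|a − G(v,a) v|² = 0`). [folklore] -/
theorem eq_smul_of_apply_self_eq_sq
    {B : EuclideanSpace ℝ (Fin 3) →L[ℝ] EuclideanSpace ℝ (Fin 3) →L[ℝ] ℝ}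
    (hpos : ∀ x, x ≠ 0 → 0 < B x x) (hsymm : ∀ x y, B x y = B y x)
    {v a : EuclideanSpace ℝ (Fin 3)} (hv : B v v = 1) (ha : B a a = (B v a) ^ 2) :
    a = B v a • v := by
  by_contra hne
  have hlt := hpos _ (sub_ne_zero.2 hne)
  have h0 : B (a - B v a • v) (a - B v a • v) = 0 := by
    simp only [map_sub, map_smul, _root_.sub_apply, FunLike.coe_smul, Pi.smul_apply, smul_eq_mul]
    rw [hsymm a v, hv, ha]
    ring
  exact hlt.ne' h0

/-! ### Reading `κ`, `σ`, `h` and the null directions in a chart with the null data -/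

/-- **Chart reading of the global quantities.** In a chart around `x` carrying the null data
(`v` unit, `Ric(v, ·) = 0`, `Ric = (S/2)(G − θ⊗θ)`), with `u = φ x`, `a = dφ w`, `θ = G(v, ·)`,
`û = Df̂(v)`: `g(w,w) − (2/S)Ric(w,w) = θ(a)²`, `df(w) − (2/S)Ric(∇f, w) = û θ(a)`,
`|∇f|² − (2/S)Ric(∇f,∇f) = û²`; and a null vector of `Ric` is `Ric`-orthogonal to everything.
[cite: PetersenWylie2010, §3] -/
theorem chart_reading (x₁ : M) {f : M → ℝ} (hf : ContMDiff (𝓡 3) 𝓘(ℝ, ℝ) ∞ f)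
    {O : Set (EuclideanSpace ℝ (Fin 3))} {v : EuclideanSpace ℝ (Fin 3) → EuclideanSpace ℝ (Fin 3)}
    (hGm : MetricCoord.IsMetricOn (chartRep (𝓡 3) (fun _ ↦ g) x₁ 0) (extChartAt (𝓡 3) x₁).target)
    (hGpos : ∀ y ∈ (extChartAt (𝓡 3) x₁).target, ∀ a : EuclideanSpace ℝ (Fin 3), a ≠ 0 →
      0 < chartRep (𝓡 3) (fun _ ↦ g) x₁ 0 y a a)
    (hunit : ∀ z ∈ O, chartRep (𝓡 3) (fun _ ↦ g) x₁ 0 z (v z) (v z) = 1)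
    (hnullO : ∀ z ∈ O, ∀ Z, MetricCoord.ricAt (chartRep (𝓡 3) (fun _ ↦ g) x₁ 0) z (v z) Z = 0)
    (hRicO : ∀ z ∈ O, ∀ W Z, MetricCoord.ricAt (chartRep (𝓡 3) (fun _ ↦ g) x₁ 0) z W Z =
      MetricCoord.scalAt (chartRep (𝓡 3) (fun _ ↦ g) x₁ 0) z / 2 *
        (chartRep (𝓡 3) (fun _ ↦ g) x₁ 0 z W Z - chartRep (𝓡 3) (fun _ ↦ g) x₁ 0 z (v z) W *
          chartRep (𝓡 3) (fun _ ↦ g) x₁ 0 z (v z) Z))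
    (hSO : ∀ y ∈ (extChartAt (𝓡 3) x₁).target,
      0 < MetricCoord.scalAt (chartRep (𝓡 3) (fun _ ↦ g) x₁ 0) y)
    {x : M} (hx : x ∈ (extChartAt (𝓡 3) x₁).source) (hxO : extChartAt (𝓡 3) x₁ x ∈ O)
    (w : TangentSpace (𝓡 3) x) :
    (g.val x w w - 2 / g.scalarCurvature x * g.ricci x w w =
      (chartRep (𝓡 3) (fun _ ↦ g) x₁ 0 (extChartAt (𝓡 3) x₁ x) (v (extChartAt (𝓡 3) x₁ x))
        (mfderiv (𝓡 3) (𝓡 3) (extChartAt (𝓡 3) x₁) x w)) ^ 2) ∧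
    (mvfderiv (𝓡 3) f x w - 2 / g.scalarCurvature x *
        g.ricci x (g.sharp x (mvfderiv (𝓡 3) f x : TangentSpace (𝓡 3) x →ₗ[ℝ] ℝ)) w =
      fderiv ℝ (f ∘ (extChartAt (𝓡 3) x₁).symm) (extChartAt (𝓡 3) x₁ x)
          (v (extChartAt (𝓡 3) x₁ x)) *
        chartRep (𝓡 3) (fun _ ↦ g) x₁ 0 (extChartAt (𝓡 3) x₁ x) (v (extChartAt (𝓡 3) x₁ x))
          (mfderiv (𝓡 3) (𝓡 3) (extChartAt (𝓡 3) x₁) x w)) ∧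
    (g.gradSq f x - 2 / g.scalarCurvature x *
        g.ricci x (g.sharp x (mvfderiv (𝓡 3) f x : TangentSpace (𝓡 3) x →ₗ[ℝ] ℝ))
          (g.sharp x (mvfderiv (𝓡 3) f x : TangentSpace (𝓡 3) x →ₗ[ℝ] ℝ)) =
      (fderiv ℝ (f ∘ (extChartAt (𝓡 3) x₁).symm) (extChartAt (𝓡 3) x₁ x)
        (v (extChartAt (𝓡 3) x₁ x))) ^ 2) ∧
    (g.ricci x w w = 0 → ∀ w' : TangentSpace (𝓡 3) x, g.ricci x w w' = 0 ∧ g.ricci x w' w = 0) := by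
  have huT : extChartAt (𝓡 3) x₁ x ∈ (extChartAt (𝓡 3) x₁).target :=
    (extChartAt (𝓡 3) x₁).map_source hx
  have hi := hGm.isInvertible _ huT
  have hsy := hGm.symm _ huT
  have hSu := (hSO _ huT).ne'
  obtain ⟨d1, d2, d3, d4, d5, d6, d7, -⟩ := dictionary_source g x₁ hx hf w w
  refine ⟨?_, ?_, ?_, fun hww w' ↦ ?_⟩
  · rw [d1, d2, d3, hRicO _ hxO]
    field_simp
    ring
  · rw [d4, d3, d5, hRicO _ hxO, MetricCoord.apply_sharpAt_apply hi, hsy (v _),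
      MetricCoord.apply_sharpAt_apply hi]
    field_simp
    ring
  · rw [d7, d3, d6, hRicO _ hxO, MetricCoord.apply_sharpAt_apply hi, hsy (v _),
      MetricCoord.apply_sharpAt_apply hi, MetricCoord.gradSqAt_apply]
    field_simp
    ring
  · -- `a = dφ w` is null: `G(a,a) = θ(a)²`, so `a = θ(a) v`
    have hnull : MetricCoord.ricAt (chartRep (𝓡 3) (fun _ ↦ g) x₁ 0) (extChartAt (𝓡 3) x₁ x)
        (mfderiv (𝓡 3) (𝓡 3) (extChartAt (𝓡 3) x₁) x w)
        (mfderiv (𝓡 3) (𝓡 3) (extChartAt (𝓡 3) x₁) x w) = 0 := by rw [← d2]; exact hww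
    have hsq : chartRep (𝓡 3) (fun _ ↦ g) x₁ 0 (extChartAt (𝓡 3) x₁ x)
        (mfderiv (𝓡 3) (𝓡 3) (extChartAt (𝓡 3) x₁) x w)
        (mfderiv (𝓡 3) (𝓡 3) (extChartAt (𝓡 3) x₁) x w) =
        (chartRep (𝓡 3) (fun _ ↦ g) x₁ 0 (extChartAt (𝓡 3) x₁ x) (v (extChartAt (𝓡 3) x₁ x))
          (mfderiv (𝓡 3) (𝓡 3) (extChartAt (𝓡 3) x₁) x w)) ^ 2 := by
      rw [hRicO _ hxO] at hnull
      have h2 : MetricCoord.scalAt (chartRep (𝓡 3) (fun _ ↦ g) x₁ 0) (extChartAt (𝓡 3) x₁ x) / 2 ≠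
          0 := div_ne_zero hSu two_ne_zero
      have h3 := (mul_eq_zero.mp hnull).resolve_left h2
      rw [sq]; linarith
    have hav := eq_smul_of_apply_self_eq_sq (hGpos _ huT) hsy (hunit _ hxO) hsq
    obtain ⟨-, e1, -⟩ := dictionary_source g x₁ hx hf w w'
    obtain ⟨-, e2, -⟩ := dictionary_source g x₁ hx hf w' w
    refine ⟨?_, ?_⟩
    · rw [e1, hav, map_smul, FunLike.coe_smul, Pi.smul_apply, hnullO _ hxO, smul_zero]
    · rw [e2, hGm.ricAt_comm huT, hav, map_smul, FunLike.coe_smul, Pi.smul_apply, hnullO _ hxO,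
        smul_zero]

/-- **`|∇f|² = 0` forces `df = 0`** for a Riemannian metric (`|∇f|² = G(♯df, ♯df)` in a chart,
`G` positive definite). [folklore] -/
theorem mvfderiv_eq_zero_of_gradSq_eq_zero (hg : g.IsRiemannian) {f : M → ℝ}
    (hf : ContMDiff (𝓡 3) 𝓘(ℝ, ℝ) ∞ f) {x : M} (h0 : g.gradSq f x = 0) :
    mvfderiv (𝓡 3) f x = 0 := by
  set G := chartRep (𝓡 3) (fun _ ↦ g) x 0 with hGdef
  set T : Set (EuclideanSpace ℝ (Fin 3)) := (extChartAt (𝓡 3) x).target with hT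
  have hGm : MetricCoord.IsMetricOn G T :=
    Lorentzian.OpensChart.isMetricOn_repr (val_chartPullback_eq_chartRep (fun _ : ℝ ↦ g) x 0)
  have hGpos : ∀ y ∈ T, ∀ v : EuclideanSpace ℝ (Fin 3), v ≠ 0 → 0 < G y v v := by
    intro y hy v hv
    rw [hGdef, show y = ((⟨y, hy⟩ : chartTarget (𝓡 3) x) : EuclideanSpace ℝ (Fin 3)) from rfl,
      chartRep_apply]
    exact chartPullback_pos g x ⟨y, hy⟩ (fun w hw ↦ hg _ w hw) v hv
  set u := extChartAt (𝓡 3) x x with hu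
  have huT : u ∈ T := mem_extChartAt_target x
  have hi := hGm.isInvertible u huT
  set fc := f ∘ (extChartAt (𝓡 3) x).symm with hfc
  have hxs : x ∈ (extChartAt (𝓡 3) x).source := mem_extChartAt_source x
  -- `♯ Df̂ = 0`
  have hsharp : MetricCoord.sharpAt G u (fderiv ℝ fc u) = 0 := by
    by_contra hne
    have hpos := hGpos u huT _ hne
    rw [MetricCoord.apply_sharpAt_apply hi, ← MetricCoord.gradSqAt_apply] at hpos
    obtain ⟨-, -, -, -, -, -, d6, -⟩ := dictionary_source g x hxs hf (0 : TangentSpace (𝓡 3) x) 0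
    rw [← d6, h0] at hpos
    exact lt_irrefl _ hpos
  have hDf : fderiv ℝ fc u = 0 := by
    ext a
    rw [← MetricCoord.apply_sharpAt_apply hi (fderiv ℝ fc u) a, hsharp, map_zero]
  ext w
  obtain ⟨-, -, -, d4, -⟩ := dictionary_source g x hxs hf w w
  rw [d4]
  change fderiv ℝ fc u _ = 0
  rw [hDf]
  rfl

section Along

variable [T2Space M] [ConnectedSpace M]
  -- `hg : g.IsRiemannian`, unfolded (positive definiteness on every tangent space)
  (hg : ∀ (x : M) (v : TangentSpace (𝓡 3) x), v ≠ 0 → 0 < g.val x v v)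
  {f : M → ℝ} (hf : ContMDiff (𝓡 3) 𝓘(ℝ, ℝ) ∞ f) {lam : ℝ}
  (hsol : ∀ (x : M) (X Y : TangentSpace (𝓡 3) x),
    g.ricci x X Y + g.hessian f x X Y = lam * g.val x X Y)
  (hRic0 : ∀ (x : M) (w : TangentSpace (𝓡 3) x), 0 ≤ g.ricci x w w)
  (hS : ∀ x, 0 < g.scalarCurvature x) {p₀ : M} {w₀ : TangentSpace (𝓡 3) p₀} (hw₀ : w₀ ≠ 0)
  (hnull : g.ricci p₀ w₀ w₀ = 0)
  {gradf : (x : M) → TangentSpace (𝓡 3) x}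
  (hgradf : ∀ x, gradf x = g.sharp x (mvfderiv (𝓡 3) f x : TangentSpace (𝓡 3) x →ₗ[ℝ] ℝ))
  {H : M → ℝ}
  (hH : ∀ x, H x = g.gradSq f x - 2 / g.scalarCurvature x * g.ricci x (gradf x) (gradf x))
  {κ : (x : M) → TangentSpace (𝓡 3) x → ℝ}
  (hκ : ∀ (x : M) (w : TangentSpace (𝓡 3) x),
    κ x w = g.val x w w - 2 / g.scalarCurvature x * g.ricci x w w)
  {σ : (x : M) → TangentSpace (𝓡 3) x → ℝ}
  (hσ : ∀ (x : M) (w : TangentSpace (𝓡 3) x),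
    σ x w = mvfderiv (𝓡 3) f x w - 2 / g.scalarCurvature x * g.ricci x (gradf x) w)
include hg hf hsol hRic0 hS hw₀ hnull

/-! ### Pointwise consequences -/

omit [T2Space M] in
include hgradf hH hκ hσ in
/-- **`σ(w)² = h κ(w)`** (`σ = û θ(w)`, `h = û²`, `κ = θ(w)²`). [cite: PetersenWylie2010, §3] -/
theorem sigma_sq_eq (x : M) (w : TangentSpace (𝓡 3) x) : σ x w ^ 2 = H x * κ x w := by
  obtain ⟨hGm, hGpos, -, -, hSpos, O, -, hu₀O, hOT, v, -, -, hunit, hnullO, hRicO, -⟩ :=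
    exists_chart_data g hg hf hsol hRic0 hS hw₀ hnull x
  obtain ⟨h1, h2, h3, -⟩ := chart_reading g x hf hGm hGpos hunit hnullO hRicO hSpos
    (mem_extChartAt_source x) hu₀O w
  rw [hσ, hH, hκ, hgradf, h1, h2, h3]
  ring

omit [T2Space M] in
include hκ in
/-- **`0 ≤ κ(w)`** (`κ = θ(w)²`). [cite: PetersenWylie2010, §3] -/
theorem kappa_nonneg (x : M) (w : TangentSpace (𝓡 3) x) : 0 ≤ κ x w := by
  obtain ⟨hGm, hGpos, -, -, hSpos, O, -, hu₀O, hOT, v, -, -, hunit, hnullO, hRicO, -⟩ :=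
    exists_chart_data g hg hf hsol hRic0 hS hw₀ hnull x
  obtain ⟨h1, -⟩ := chart_reading g x hf hGm hGpos hunit hnullO hRicO hSpos
    (mem_extChartAt_source x) hu₀O w
  rw [hκ, h1]
  exact sq_nonneg _

omit [T2Space M] [ConnectedSpace M] hg hf hsol hRic0 hw₀ hnull in
include hκ in
/-- `Ric(w, w) = (S/2)(g(w,w) − κ(w))` (the definition of `κ`, solved for `Ric`). [folklore] -/
theorem ricci_eq_of_kappa (x : M) (w : TangentSpace (𝓡 3) x) :
    g.ricci x w w = g.scalarCurvature x / 2 * (g.val x w w - κ x w) := by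
  rw [hκ]
  field_simp [(hS x).ne']
  ring

omit [T2Space M] in
/-- **A null vector of `Ric` is `Ric`-orthogonal to every vector** (it spans the null line).
[cite: PetersenWylie2010, §3] -/
theorem ricci_eq_zero_of_ricci_self {x : M} {w : TangentSpace (𝓡 3) x} (hw : g.ricci x w w = 0)
    (w' : TangentSpace (𝓡 3) x) : g.ricci x w w' = 0 ∧ g.ricci x w' w = 0 := by
  obtain ⟨hGm, hGpos, -, -, hSpos, O, -, hu₀O, hOT, v, -, -, hunit, hnullO, hRicO, -⟩ :=
    exists_chart_data g hg hf hsol hRic0 hS hw₀ hnull x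
  exact (chart_reading g x hf hGm hGpos hunit hnullO hRicO hSpos (mem_extChartAt_source x)
    hu₀O w).2.2.2 hw w'

omit [T2Space M] in
/-- **Every point carries a unit null vector of `Ric`.** [cite: PetersenWylie2010, §3] -/
theorem exists_unit_null (x : M) :
    ∃ w : TangentSpace (𝓡 3) x,
      g.val x w w = 1 ∧ ∀ w', g.ricci x w w' = 0 ∧ g.ricci x w' w = 0 := by
  obtain ⟨hGm, hGpos, -, -, hSpos, O, -, hu₀O, hOT, v, -, -, hunit, hnullO, hRicO, -⟩ :=
    exists_chart_data g hg hf hsol hRic0 hS hw₀ hnull x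
  set u : chartTarget (𝓡 3) x := ⟨extChartAt (𝓡 3) x x, mem_extChartAt_target x⟩ with hu
  have hx : chartInv (𝓡 3) x u = x := extChartAt_to_inv x
  set w := mfderiv 𝓘(ℝ, EuclideanSpace ℝ (Fin 3)) (𝓡 3) (chartInv (𝓡 3) x) u (v u) with hw
  have h1 : g.val (chartInv (𝓡 3) x u) w w = 1 := by
    rw [hw, val_chartInv_mfderiv_eq_chartRep]; exact hunit _ hu₀O
  have h2 : g.ricci (chartInv (𝓡 3) x u) w w = 0 := by
    rw [hw, ricci_chartInv_mfderiv_eq_ricAt]; exact hnullO _ hu₀O _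
  rw [hx] at h1 h2
  exact ⟨w, h1, fun w' ↦ ricci_eq_zero_of_ricci_self g hg hf hsol hRic0 hS hw₀ hnull h2 w'⟩

omit [T2Space M] in
include hgradf hH in
/-- **`h` is continuous** (locally `h = Df̂(v)²` read through the chart). [folklore] -/
theorem continuous_H : Continuous H := by
  refine continuous_iff_continuousAt.2 fun x ↦ ?_
  obtain ⟨hGm, hGpos, hfcs, -, hSpos, O, hOo, hu₀O, hOT, v, hvs, -, hunit, hnullO, hRicO, -⟩ :=
    exists_chart_data g hg hf hsol hRic0 hS hw₀ hnull x
  set fc := f ∘ (extChartAt (𝓡 3) x).symm with hfc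
  -- the continuous local model `F = Df̂(v)`
  have hTo : IsOpen (extChartAt (𝓡 3) x).target := isOpen_extChartAt_target x
  have hF : ContinuousOn (fun z ↦ fderiv ℝ fc z (v z)) O :=
    ((hfcs.continuousOn_fderiv_of_isOpen hTo (by simp)).mono hOT).clm_apply hvs.continuousOn
  have hFx : ContinuousAt (fun y : M ↦ (fderiv ℝ fc (extChartAt (𝓡 3) x y)
      (v (extChartAt (𝓡 3) x y))) ^ 2) x :=
    (((hF.continuousAt (hOo.mem_nhds hu₀O)).comp (continuousAt_extChartAt x)).pow 2)
  refine hFx.congr ?_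
  have h1 : ∀ᶠ y in 𝓝 x, extChartAt (𝓡 3) x y ∈ O :=
    (continuousAt_extChartAt (I := 𝓡 3) x).eventually (hOo.mem_nhds hu₀O)
  filter_upwards [h1, extChartAt_source_mem_nhds (I := 𝓡 3) x] with y hy hys
  obtain ⟨-, -, h3, -⟩ := chart_reading g x hf hGm hGpos hunit hnullO hRicO hSpos hys hy
    (0 : TangentSpace (𝓡 3) y)
  rw [hH, hgradf, h3]

/-! ### Along geodesics -/

include hκ in
/-- **`κ(γ̇)` has zero derivative along a geodesic** (`κ(γ̇) = θ(γ̇)²`, and `θ(γ̇)` is constant: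
`v` is parallel, `γ̇` is parallel).
[cite: ONeill1983, Ch. 3, Lemma 3.20] [cite: PetersenWylie2010, §3] -/
theorem hasDerivAt_kappa_velocity {γ : ℝ → M} (hγ : IsGeodesicOn g.leviCivita γ univ) (t : ℝ) :
    HasDerivAt (fun s ↦ κ (γ s) (velocity (𝓡 3) γ s)) 0 t := by
  obtain ⟨hGm, hGpos, -, -, hSpos, O, hOo, hu₀O, hOT, v, hvs, hpar, hunit, hnullO, hRicO, -⟩ :=
    exists_chart_data g hg hf hsol hRic0 hS hw₀ hnull (γ t)
  have hev := IsGeodesicOn.eventually_hasDerivAt_chart g (γ t) isOpen_univ hγ (mem_univ t)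
    (mem_extChartAt_source (γ t))
  obtain ⟨-, hct, hUt⟩ := hev.self_of_nhds
  have hcO : ∀ᶠ s in 𝓝 t, extChartAt (𝓡 3) (γ t) (γ s) ∈ O :=
    hct.continuousAt.preimage_mem_nhds (hOo.mem_nhds hu₀O)
  have hθ := (hGm.mono hOo hOT).hasDerivAt_theta_velocity hvs hpar
    (γ := fun s ↦ extChartAt (𝓡 3) (γ t) (γ s))
    (U := fun s ↦ mfderiv (𝓡 3) (𝓡 3) (extChartAt (𝓡 3) (γ t)) (γ s) (velocity (𝓡 3) γ s))
    (s := t) hcO.self_of_nhds hct hUt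
  have hθ2 : HasDerivAt (fun s ↦ (chartRep (𝓡 3) (fun _ ↦ g) (γ t) 0 (extChartAt (𝓡 3) (γ t) (γ s))
      (v (extChartAt (𝓡 3) (γ t) (γ s)))
      (mfderiv (𝓡 3) (𝓡 3) (extChartAt (𝓡 3) (γ t)) (γ s) (velocity (𝓡 3) γ s))) ^ 2)
      ((2 : ℕ) * (chartRep (𝓡 3) (fun _ ↦ g) (γ t) 0 (extChartAt (𝓡 3) (γ t) (γ t))
        (v (extChartAt (𝓡 3) (γ t) (γ t)))
        (mfderiv (𝓡 3) (𝓡 3) (extChartAt (𝓡 3) (γ t)) (γ t) (velocity (𝓡 3) γ t))) ^ (2 - 1) * 0)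
      t := hθ.pow 2
  rw [mul_zero] at hθ2
  refine hθ2.congr_of_eventuallyEq ?_
  filter_upwards [hev, hcO] with s hs hsO
  obtain ⟨h1, -⟩ := chart_reading g (γ t) hf hGm hGpos hunit hnullO hRicO hSpos hs.1 hsO
    (velocity (𝓡 3) γ s)
  rw [hκ, h1]

include hκ in
/-- **`κ(γ̇)` is constant along a geodesic defined on `ℝ`.**
[cite: ONeill1983, Ch. 3, Lemma 3.20] -/
theorem kappa_velocity_eq {γ : ℝ → M} (hγ : IsGeodesicOn g.leviCivita γ univ) (t : ℝ) :
    κ (γ t) (velocity (𝓡 3) γ t) = κ (γ 0) (velocity (𝓡 3) γ 0) :=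
  is_const_of_deriv_eq_zero
    (fun s ↦ (hasDerivAt_kappa_velocity g hg hf hsol hRic0 hS hw₀ hnull hκ hγ s).differentiableAt)
    (fun s ↦ (hasDerivAt_kappa_velocity g hg hf hsol hRic0 hS hw₀ hnull hκ hγ s).deriv) t 0

include hgradf hH hσ in
/-- **`(h ∘ γ)' = 2λ σ(γ̇)`** (`h = û²`, `dû = λθ`, so `(û²)' = 2 û λ θ(γ̇) = 2λ σ(γ̇)`).
[cite: PetersenWylie2010, §3] -/
theorem hasDerivAt_H {γ : ℝ → M} (hγ : IsGeodesicOn g.leviCivita γ univ) (t : ℝ) :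
    HasDerivAt (fun s ↦ H (γ s)) (2 * lam * σ (γ t) (velocity (𝓡 3) γ t)) t := by
  obtain ⟨hGm, hGpos, hfcs, hsolc, hSpos, O, hOo, hu₀O, hOT, v, hvs, hpar, hunit, hnullO, hRicO,
    -⟩ := exists_chart_data g hg hf hsol hRic0 hS hw₀ hnull (γ t)
  have hev := IsGeodesicOn.eventually_hasDerivAt_chart g (γ t) isOpen_univ hγ (mem_univ t)
    (mem_extChartAt_source (γ t))
  obtain ⟨hsrc, hct, hUt⟩ := hev.self_of_nhds
  have hcO : ∀ᶠ s in 𝓝 t, extChartAt (𝓡 3) (γ t) (γ s) ∈ O :=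
    hct.continuousAt.preimage_mem_nhds (hOo.mem_nhds hu₀O)
  have hGO := hGm.mono hOo hOT
  have hsolO : ∀ y ∈ O, ∀ a b, MetricCoord.ricAt (chartRep (𝓡 3) (fun _ ↦ g) (γ t) 0) y a b +
      MetricCoord.hessAt (chartRep (𝓡 3) (fun _ ↦ g) (γ t) 0) (f ∘ (extChartAt (𝓡 3) (γ t)).symm)
        y a b = lam * chartRep (𝓡 3) (fun _ ↦ g) (γ t) 0 y a b := fun y hy ↦ hsolc y (hOT hy)
  -- `û' = λ θ(γ̇)`
  have hu := (hGO.hasFDerivAt_fderiv_apply_null (hfcs.mono hOT) hsolO hvs hpar hnullO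
    hcO.self_of_nhds).comp_hasDerivAt t hct
  have hu2 := hu.pow 2
  refine (hu2.congr_of_eventuallyEq ?_).congr_deriv ?_
  · filter_upwards [hev, hcO] with s hs hsO
    obtain ⟨-, -, h3, -⟩ := chart_reading g (γ t) hf hGm hGpos hunit hnullO hRicO hSpos hs.1
      hsO (velocity (𝓡 3) γ s)
    change H (γ s) = (fderiv ℝ (f ∘ (extChartAt (𝓡 3) (γ t)).symm) (extChartAt (𝓡 3) (γ t) (γ s))
      (v (extChartAt (𝓡 3) (γ t) (γ s)))) ^ 2
    rw [hH, hgradf, h3]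
  · obtain ⟨-, h2, -⟩ := chart_reading g (γ t) hf hGm hGpos hunit hnullO hRicO hSpos hsrc
      hcO.self_of_nhds (velocity (𝓡 3) γ t)
    rw [hσ, hgradf, h2]
    simp only [Function.comp_apply, FunLike.coe_smul, Pi.smul_apply, smul_eq_mul]
    push_cast
    ring

include hgradf hκ hσ in
/-- **`(σ(γ̇))' = λ κ(γ̇)`** (`σ = û θ(γ̇)`, `û' = λ θ(γ̇)`, `θ(γ̇)' = 0`).
[cite: PetersenWylie2010, §3] -/
theorem hasDerivAt_sigma_velocity {γ : ℝ → M} (hγ : IsGeodesicOn g.leviCivita γ univ) (t : ℝ) :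
    HasDerivAt (fun s ↦ σ (γ s) (velocity (𝓡 3) γ s)) (lam * κ (γ t) (velocity (𝓡 3) γ t)) t := by
  obtain ⟨hGm, hGpos, hfcs, hsolc, hSpos, O, hOo, hu₀O, hOT, v, hvs, hpar, hunit, hnullO, hRicO,
    -⟩ := exists_chart_data g hg hf hsol hRic0 hS hw₀ hnull (γ t)
  have hev := IsGeodesicOn.eventually_hasDerivAt_chart g (γ t) isOpen_univ hγ (mem_univ t)
    (mem_extChartAt_source (γ t))
  obtain ⟨hsrc, hct, hUt⟩ := hev.self_of_nhds
  have hcO : ∀ᶠ s in 𝓝 t, extChartAt (𝓡 3) (γ t) (γ s) ∈ O :=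
    hct.continuousAt.preimage_mem_nhds (hOo.mem_nhds hu₀O)
  have hGO := hGm.mono hOo hOT
  have hsolO : ∀ y ∈ O, ∀ a b, MetricCoord.ricAt (chartRep (𝓡 3) (fun _ ↦ g) (γ t) 0) y a b +
      MetricCoord.hessAt (chartRep (𝓡 3) (fun _ ↦ g) (γ t) 0) (f ∘ (extChartAt (𝓡 3) (γ t)).symm)
        y a b = lam * chartRep (𝓡 3) (fun _ ↦ g) (γ t) 0 y a b := fun y hy ↦ hsolc y (hOT hy)
  have hu := (hGO.hasFDerivAt_fderiv_apply_null (hfcs.mono hOT) hsolO hvs hpar hnullO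
    hcO.self_of_nhds).comp_hasDerivAt t hct
  have hθ := hGO.hasDerivAt_theta_velocity hvs hpar
    (γ := fun s ↦ extChartAt (𝓡 3) (γ t) (γ s))
    (U := fun s ↦ mfderiv (𝓡 3) (𝓡 3) (extChartAt (𝓡 3) (γ t)) (γ s) (velocity (𝓡 3) γ s))
    (s := t) hcO.self_of_nhds hct hUt
  have hprod := hu.mul hθ
  refine (hprod.congr_of_eventuallyEq ?_).congr_deriv ?_
  · filter_upwards [hev, hcO] with s hs hsO
    obtain ⟨-, h2, -⟩ := chart_reading g (γ t) hf hGm hGpos hunit hnullO hRicO hSpos hs.1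
      hsO (velocity (𝓡 3) γ s)
    change σ (γ s) (velocity (𝓡 3) γ s) =
      fderiv ℝ (f ∘ (extChartAt (𝓡 3) (γ t)).symm) (extChartAt (𝓡 3) (γ t) (γ s))
          (v (extChartAt (𝓡 3) (γ t) (γ s))) *
        chartRep (𝓡 3) (fun _ ↦ g) (γ t) 0 (extChartAt (𝓡 3) (γ t) (γ s))
          (v (extChartAt (𝓡 3) (γ t) (γ s)))
          (mfderiv (𝓡 3) (𝓡 3) (extChartAt (𝓡 3) (γ t)) (γ s) (velocity (𝓡 3) γ s))
    rw [hσ, hgradf, h2]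
  · obtain ⟨h1, -⟩ := chart_reading g (γ t) hf hGm hGpos hunit hnullO hRicO hSpos hsrc
      hcO.self_of_nhds (velocity (𝓡 3) γ t)
    rw [hκ, h1]
    simp only [Function.comp_apply, FunLike.coe_smul, Pi.smul_apply, smul_eq_mul, mul_zero,
      add_zero]
    ring

include hgradf hH hκ hσ in
/-- **The quadratic law for `h` along a geodesic**:
`h(γ t) = h(γ 0) + 2λ σ₀ t + λ² κ₀ t²`, `σ₀ = σ(γ̇(0))`, `κ₀ = κ(γ̇(0))`.
[cite: PetersenWylie2010, §3] -/
theorem H_comp_geodesic_eq {γ : ℝ → M} (hγ : IsGeodesicOn g.leviCivita γ univ) (t : ℝ) :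
    H (γ t) = H (γ 0) + 2 * lam * σ (γ 0) (velocity (𝓡 3) γ 0) * t +
      lam ^ 2 * κ (γ 0) (velocity (𝓡 3) γ 0) * t ^ 2 := by
  have hF := fun s ↦ hasDerivAt_H g hg hf hsol hRic0 hS hw₀ hnull hgradf hH hσ hγ s
  have hG : ∀ s, HasDerivAt (fun s ↦ 2 * lam * σ (γ s) (velocity (𝓡 3) γ s))
      (2 * lam ^ 2 * κ (γ 0) (velocity (𝓡 3) γ 0)) s := by
    intro s
    have h := (hasDerivAt_sigma_velocity g hg hf hsol hRic0 hS hw₀ hnull hgradf hκ hσ hγ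
      s).const_mul (2 * lam)
    rw [kappa_velocity_eq g hg hf hsol hRic0 hS hw₀ hnull hκ hγ s] at h
    exact h.congr_deriv (by ring)
  have h := ThreeShrinker.eq_quadratic_of_hasDerivAt hF hG t
  rw [h]
  ring

/-- **`(f ∘ γ)' = df(γ̇)`** along a geodesic (read in a chart). [folklore] -/
theorem hasDerivAt_f {γ : ℝ → M} (hγ : IsGeodesicOn g.leviCivita γ univ) (t : ℝ) :
    HasDerivAt (fun s ↦ f (γ s)) (mvfderiv (𝓡 3) f (γ t) (velocity (𝓡 3) γ t)) t := by
  obtain ⟨hGm, -, hfcs, -⟩ := exists_chart_data g hg hf hsol hRic0 hS hw₀ hnull (γ t)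
  have hev := IsGeodesicOn.eventually_hasDerivAt_chart g (γ t) isOpen_univ hγ (mem_univ t)
    (mem_extChartAt_source (γ t))
  obtain ⟨hsrc, hct, -⟩ := hev.self_of_nhds
  have hTo : IsOpen (extChartAt (𝓡 3) (γ t)).target := isOpen_extChartAt_target _
  have hfd : HasFDerivAt (f ∘ (extChartAt (𝓡 3) (γ t)).symm)
      (fderiv ℝ (f ∘ (extChartAt (𝓡 3) (γ t)).symm) (extChartAt (𝓡 3) (γ t) (γ t)))
      (extChartAt (𝓡 3) (γ t) (γ t)) :=
    ((hfcs.contDiffAt (hTo.mem_nhds (mem_extChartAt_target _))).differentiableAt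
      (by simp)).hasFDerivAt
  have h := hfd.comp_hasDerivAt t hct
  refine (h.congr_of_eventuallyEq ?_).congr_deriv ?_
  · filter_upwards [hev] with s hs
    exact (dictionary_source g (γ t) hs.1 hf (velocity (𝓡 3) γ s)
      (velocity (𝓡 3) γ s)).2.2.2.2.2.2.2
  · exact (dictionary_source g (γ t) hsrc hf (velocity (𝓡 3) γ t) (velocity (𝓡 3) γ t)).2.2.2.1.symm

include hκ in
/-- **`(df(γ̇))' = λ g(γ̇,γ̇) − (S/2)(g(γ̇,γ̇) − κ(γ̇))`** along a geodesic
(`(df(γ̇))' = Hess f(γ̇,γ̇) = λ|γ̇|² − Ric(γ̇,γ̇)`). [cite: PetersenWylie2010, §3] -/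
theorem hasDerivAt_mvfderiv_velocity {γ : ℝ → M} (hγ : IsGeodesicOn g.leviCivita γ univ) (t : ℝ) :
    HasDerivAt (fun s ↦ mvfderiv (𝓡 3) f (γ s) (velocity (𝓡 3) γ s))
      (lam * g.val (γ t) (velocity (𝓡 3) γ t) (velocity (𝓡 3) γ t) -
        g.scalarCurvature (γ t) / 2 * (g.val (γ t) (velocity (𝓡 3) γ t) (velocity (𝓡 3) γ t) -
          κ (γ t) (velocity (𝓡 3) γ t))) t := by
  obtain ⟨hGm, hGpos, hfcs, hsolc, hSpos, O, hOo, hu₀O, hOT, v, hvs, hpar, hunit, hnullO, hRicO,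
    -⟩ := exists_chart_data g hg hf hsol hRic0 hS hw₀ hnull (γ t)
  have hev := IsGeodesicOn.eventually_hasDerivAt_chart g (γ t) isOpen_univ hγ (mem_univ t)
    (mem_extChartAt_source (γ t))
  obtain ⟨hsrc, hct, hUt⟩ := hev.self_of_nhds
  have hcO : ∀ᶠ s in 𝓝 t, extChartAt (𝓡 3) (γ t) (γ s) ∈ O :=
    hct.continuousAt.preimage_mem_nhds (hOo.mem_nhds hu₀O)
  have hGO := hGm.mono hOo hOT
  have hsolO : ∀ y ∈ O, ∀ a b, MetricCoord.ricAt (chartRep (𝓡 3) (fun _ ↦ g) (γ t) 0) y a b +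
      MetricCoord.hessAt (chartRep (𝓡 3) (fun _ ↦ g) (γ t) 0) (f ∘ (extChartAt (𝓡 3) (γ t)).symm)
        y a b = lam * chartRep (𝓡 3) (fun _ ↦ g) (γ t) 0 y a b := fun y hy ↦ hsolc y (hOT hy)
  have h := hGO.hasDerivAt_fderiv_apply_parallel (hfcs.mono hOT)
    (γ := fun s ↦ extChartAt (𝓡 3) (γ t) (γ s))
    (U := fun s ↦ mfderiv (𝓡 3) (𝓡 3) (extChartAt (𝓡 3) (γ t)) (γ s) (velocity (𝓡 3) γ s))
    (s := t) hcO.self_of_nhds hct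
    (W := fun s ↦ mfderiv (𝓡 3) (𝓡 3) (extChartAt (𝓡 3) (γ t)) (γ s) (velocity (𝓡 3) γ s)) hUt
  refine (h.congr_of_eventuallyEq ?_).congr_deriv ?_
  · filter_upwards [hev] with s hs
    exact (dictionary_source g (γ t) hs.1 hf (velocity (𝓡 3) γ s) (velocity (𝓡 3) γ s)).2.2.2.1
  · obtain ⟨d1, -, d3, -⟩ := dictionary_source g (γ t) hsrc hf (velocity (𝓡 3) γ t)
      (velocity (𝓡 3) γ t)
    obtain ⟨h1, -⟩ := chart_reading g (γ t) hf hGm hGpos hunit hnullO hRicO hSpos hsrc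
      hcO.self_of_nhds (velocity (𝓡 3) γ t)
    rw [MetricCoord.IsMetricOn.hessAt_eq_of_null hsolO hRicO hcO.self_of_nhds, hκ, h1, d1, d3]
    ring

include hgradf in
/-- **`(S ∘ γ)' = 2 Ric(∇f, γ̇)`** along a geodesic (`dS = 2Ric(∇f, ·)`, the soliton identity).
[cite: PetersenWylie2010, §2] -/
theorem hasDerivAt_scalarCurvature {γ : ℝ → M} (hγ : IsGeodesicOn g.leviCivita γ univ) (t : ℝ) :
    HasDerivAt (fun s ↦ g.scalarCurvature (γ s))
      (2 * g.ricci (γ t) (gradf (γ t)) (velocity (𝓡 3) γ t)) t := by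
  obtain ⟨hGm, -, hfcs, hsolc, -⟩ := exists_chart_data g hg hf hsol hRic0 hS hw₀ hnull (γ t)
  have hev := IsGeodesicOn.eventually_hasDerivAt_chart g (γ t) isOpen_univ hγ (mem_univ t)
    (mem_extChartAt_source (γ t))
  obtain ⟨hsrc, hct, -⟩ := hev.self_of_nhds
  have huT : extChartAt (𝓡 3) (γ t) (γ t) ∈ (extChartAt (𝓡 3) (γ t)).target :=
    mem_extChartAt_target _
  have hSd : HasFDerivAt (MetricCoord.scalAt (chartRep (𝓡 3) (fun _ ↦ g) (γ t) 0))
      (fderiv ℝ (MetricCoord.scalAt (chartRep (𝓡 3) (fun _ ↦ g) (γ t) 0))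
        (extChartAt (𝓡 3) (γ t) (γ t))) (extChartAt (𝓡 3) (γ t) (γ t)) :=
    ((hGm.contDiffAt_scalAt huT).differentiableAt (by simp)).hasFDerivAt
  have h := hSd.comp_hasDerivAt t hct
  refine (h.congr_of_eventuallyEq ?_).congr_deriv ?_
  · filter_upwards [hev] with s hs
    exact (dictionary_source g (γ t) hs.1 hf (velocity (𝓡 3) γ s) (velocity (𝓡 3) γ s)).2.2.1
  · obtain ⟨-, -, -, -, d5, -⟩ := dictionary_source g (γ t) hsrc hf (velocity (𝓡 3) γ t)
      (velocity (𝓡 3) γ t)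
    rw [hgradf, d5, hGm.fderiv_scalAt_of_soliton huT hfcs hsolc]

/-! ### Null geodesics: `S` is constant, `h` has a zero -/

include hκ in
/-- **A geodesic issuing in a null direction stays null**: `Ric(γ̇, γ̇) ≡ 0`
(`Ric(γ̇,γ̇) = (S/2)(|γ̇|² − κ)`, with `|γ̇|²` and `κ` constant). [cite: PetersenWylie2010, §3] -/
theorem ricci_velocity_eq_zero {γ : ℝ → M} (hγ : IsGeodesicOn g.leviCivita γ univ)
    (h0 : g.ricci (γ 0) (velocity (𝓡 3) γ 0) (velocity (𝓡 3) γ 0) = 0) (t : ℝ) :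
    g.ricci (γ t) (velocity (𝓡 3) γ t) (velocity (𝓡 3) γ t) = 0 := by
  have hLC := PseudoRiemannianMetric.isLeviCivita_leviCivita_holds (g := g)
  have hspeed := g.val_velocity_eq_of_isGeodesicOn_of_isCompatible hLC.2 isOpen_univ
    Set.ordConnected_univ hγ (mem_univ t) (mem_univ 0)
  have hkap := kappa_velocity_eq g hg hf hsol hRic0 hS hw₀ hnull hκ hγ t
  rw [ricci_eq_of_kappa g hS hκ] at h0 ⊢
  rw [hspeed, hkap]
  have h2 : g.scalarCurvature (γ 0) / 2 ≠ 0 := div_ne_zero (hS _).ne' two_ne_zero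
  rw [(mul_eq_zero.mp h0).resolve_left h2, mul_zero]

include hgradf hκ in
/-- **`S` is constant along a null geodesic** (`S' = 2Ric(∇f, γ̇) = 0`).
[cite: PetersenWylie2010, §3] -/
theorem scalarCurvature_comp_eq_of_null {γ : ℝ → M} (hγ : IsGeodesicOn g.leviCivita γ univ)
    (h0 : g.ricci (γ 0) (velocity (𝓡 3) γ 0) (velocity (𝓡 3) γ 0) = 0) (t : ℝ) :
    g.scalarCurvature (γ t) = g.scalarCurvature (γ 0) := by
  have hd : ∀ s, HasDerivAt (fun s ↦ g.scalarCurvature (γ s)) 0 s := by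
    intro s
    have h := hasDerivAt_scalarCurvature g hg hf hsol hRic0 hS hw₀ hnull hgradf hγ s
    have hnul := ricci_velocity_eq_zero g hg hf hsol hRic0 hS hw₀ hnull hκ hγ h0 s
    rw [(ricci_eq_zero_of_ricci_self g hg hf hsol hRic0 hS hw₀ hnull hnul (gradf (γ s))).2,
      mul_zero] at h
    exact h
  exact is_const_of_deriv_eq_zero (fun s ↦ (hd s).differentiableAt) (fun s ↦ (hd s).deriv) t 0

include hgradf hH hκ hσ in
/-- **`h` vanishes somewhere on every unit-speed null geodesic**: with `|γ̇(0)|² = 1`,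
`Ric(γ̇(0), γ̇(0)) = 0` one has `κ₀ = 1`, `σ₀² = h(γ 0)`, and
`h(γ t) = (λ t + σ₀)²` vanishes at `t = −σ₀/λ`. [cite: PetersenWylie2010, §3] -/
theorem H_eq_zero_of_null (hlam : lam ≠ 0) {γ : ℝ → M} (hγ : IsGeodesicOn g.leviCivita γ univ)
    (h1 : g.val (γ 0) (velocity (𝓡 3) γ 0) (velocity (𝓡 3) γ 0) = 1)
    (h0 : g.ricci (γ 0) (velocity (𝓡 3) γ 0) (velocity (𝓡 3) γ 0) = 0) :
    H (γ (-(σ (γ 0) (velocity (𝓡 3) γ 0)) / lam)) = 0 := by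
  have hk : κ (γ 0) (velocity (𝓡 3) γ 0) = 1 := by rw [hκ, h1, h0, mul_zero, sub_zero]
  have hsq := sigma_sq_eq g hg hf hsol hRic0 hS hw₀ hnull hgradf hH hκ hσ (γ 0) (velocity (𝓡 3) γ 0)
  rw [hk, mul_one] at hsq
  rw [H_comp_geodesic_eq g hg hf hsol hRic0 hS hw₀ hnull hgradf hH hκ hσ hγ, hk, ← hsq]
  field_simp
  ring

/-! ### The critical level `Σ₀ = {h = 0}`: non-empty, carries all values of `S`, compact -/

include hgradf hH hκ hσ in
/-- **Every value of `S` is attained on `Σ₀ = {h = 0}`**: follow the null geodesic from `x`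
(complete connection) to its point on `Σ₀`; `S` is constant along it.
[cite: MunteanuWang2016, Thm. 1.2] [cite: PetersenWylie2010, §3] -/
theorem exists_H_eq_zero_scalarCurvature_eq (hlam : lam ≠ 0)
    (hc : IsGeodesicallyComplete g.leviCivita) (x : M) :
    ∃ y : M, H y = 0 ∧ g.scalarCurvature y = g.scalarCurvature x := by
  haveI := contMDiffCovariantDerivative_leviCivita_one g
  obtain ⟨w, hw1, hw0⟩ := exists_unit_null g hg hf hsol hRic0 hS hw₀ hnull x
  obtain ⟨-, hgeo, hγ0, hγw⟩ := maximalGeodesic_of_isGeodesicallyComplete hc x w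
  set γ := maximalGeodesic g.leviCivita x w with hγ
  have h1 : g.val (γ 0) (velocity (𝓡 3) γ 0) (velocity (𝓡 3) γ 0) = 1 := by
    rw [hγw, show γ 0 = x from hγ0]; exact hw1
  have h0 : g.ricci (γ 0) (velocity (𝓡 3) γ 0) (velocity (𝓡 3) γ 0) = 0 := by
    rw [hγw, show γ 0 = x from hγ0]; exact (hw0 w).1
  refine ⟨γ (-(σ (γ 0) (velocity (𝓡 3) γ 0)) / lam),
    H_eq_zero_of_null g hg hf hsol hRic0 hS hw₀ hnull hgradf hH hκ hσ hlam hgeo h1 h0, ?_⟩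
  rw [scalarCurvature_comp_eq_of_null g hg hf hsol hRic0 hS hw₀ hnull hgradf hκ hgeo h0,
    show γ 0 = x from hγ0]

include hgradf hH hκ hσ in
/-- **Two points of `Σ₀` are at distance `≤ 2π/√C`** when `S ≥ C > 0`: along a unit-speed
minimising geodesic from `p` to `q` (Hopf–Rinow), `σ₀ = 0` (`σ₀² = h(p) κ₀ = 0`) and then
`0 = h(q) = λ² κ₀ ℓ²` forces `κ ≡ 0`, so `Ric(γ̇, γ̇) = S/2 ≥ (3 − 1)(C/4)`, and the second
variation (Myers) estimate gives `ℓ √(C/4) ≤ π`.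
[cite: Myers1941, Thm. 1] [cite: MunteanuWang2016, Thm. 1.2] -/
theorem edist_le_of_H_eq_zero (hlam : lam ≠ 0) (hc : IsGeodesicallyComplete g.leviCivita)
    {C : ℝ} (hC : 0 < C) (hCS : ∀ x, C ≤ g.scalarCurvature x) {p q : M} (hp : H p = 0)
    (hq : H q = 0) : g.edist hg p q ≤ ENNReal.ofReal (2 * Real.pi / Real.sqrt C) := by
  haveI := contMDiffCovariantDerivative_leviCivita_one g
  haveI := contMDiffCovariantDerivative_leviCivita_infty g le_rfl
  have hLC := PseudoRiemannianMetric.isLeviCivita_leviCivita_holds (g := g)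
  have hdim : 2 ≤ Module.finrank ℝ (EuclideanSpace ℝ (Fin 3)) := by
    rw [finrank_euclideanSpace_fin]; norm_num
  obtain ⟨v, hmin, hqv⟩ := exists_isMinimizingUpTo_of_isGeodesicallyComplete g le_rfl hg hc p q
  have hq1 : q = maximalGeodesic g.leviCivita p v 1 := by
    rw [← hqv]; exact expMap_eq_maximalGeodesic hc p v
  have hd : g.edist hg p q = ENNReal.ofReal (Real.sqrt (g.val p v v)) := by
    rw [hq1, ← hmin.2, length_maximalGeodesic hg hc p v 0 1, sub_zero, one_mul]
  rw [hd]
  apply ENNReal.ofReal_le_ofReal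
  set ℓ := Real.sqrt (g.val p v v) with hℓ
  have hsC : 0 < Real.sqrt C := Real.sqrt_pos.2 hC
  rcases (show 0 ≤ ℓ from Real.sqrt_nonneg _).eq_or_lt with hℓ0 | hℓpos
  · rw [← hℓ0]; positivity
  -- unit-speed reparametrisation
  have hvv0 : 0 ≤ g.val p v v := by
    by_cases hv : v = 0
    · simp [hv]
    · exact (hg p v hv).le
  have hvv : g.val p v v = ℓ ^ 2 := (Real.sq_sqrt hvv0).symm
  set u : TangentSpace (𝓡 3) p := ℓ⁻¹ • v with hu'
  have hu : g.val p u u = 1 := by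
    have h1 : g.val p u u = ℓ⁻¹ * ℓ⁻¹ * g.val p v v := by
      rw [hu']
      simp only [map_smul, FunLike.coe_smul, Pi.smul_apply, smul_eq_mul]
      ring
    rw [h1, hvv]
    field_simp
  have hmin' : IsMinimizingUpTo g hg p u ℓ := by
    rw [hu', isMinimizingUpTo_smul_iff hg hc p v (inv_pos.2 hℓpos), inv_mul_cancel₀ hℓpos.ne']
    exact hmin
  obtain ⟨-, hgeo, hγ0, hγu⟩ := maximalGeodesic_of_isGeodesicallyComplete hc p u
  set γ := maximalGeodesic g.leviCivita p u with hγ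
  have hγ0' : γ 0 = p := hγ0
  have hγℓ : γ ℓ = q := by
    rw [hγ, hu', maximalGeodesic_smul hc p v ℓ⁻¹ ℓ, inv_mul_cancel₀ hℓpos.ne', ← hq1]
  -- `σ₀ = 0` and `κ₀ = 0`
  have hσ0 : σ (γ 0) (velocity (𝓡 3) γ 0) = 0 := by
    have h := sigma_sq_eq g hg hf hsol hRic0 hS hw₀ hnull hgradf hH hκ hσ (γ 0) (velocity (𝓡 3) γ 0)
    rw [hγ0', hp, zero_mul] at h
    rw [hγ0']
    exact pow_eq_zero_iff (n := 2) (by norm_num) |>.1 h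
  have hκ0 : κ (γ 0) (velocity (𝓡 3) γ 0) = 0 := by
    have h := H_comp_geodesic_eq g hg hf hsol hRic0 hS hw₀ hnull hgradf hH hκ hσ hgeo ℓ
    rw [hγℓ, hq, hσ0, hγ0', hp] at h
    have h' : lam ^ 2 * ℓ ^ 2 * κ p (velocity (𝓡 3) γ 0) = 0 := by linarith
    rw [hγ0']
    exact (mul_eq_zero.mp h').resolve_left
      (mul_ne_zero (pow_ne_zero 2 hlam) (pow_ne_zero 2 hℓpos.ne'))
  -- the Ricci bound along `γ`
  have hspeed : ∀ t, g.val (γ t) (velocity (𝓡 3) γ t) (velocity (𝓡 3) γ t) = 1 := by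
    intro t
    rw [g.val_velocity_eq_of_isGeodesicOn_of_isCompatible hLC.2 isOpen_univ Set.ordConnected_univ
      hgeo (mem_univ t) (mem_univ 0), hγu, hγ0']
    exact hu
  have hRic' : ∀ t ∈ Ioo 0 ℓ, ((Module.finrank ℝ (EuclideanSpace ℝ (Fin 3)) : ℝ) - 1) * (C / 4) ≤
      g.leviCivita.ricci (maximalGeodesic g.leviCivita p u t)
        (velocity (𝓡 3) (maximalGeodesic g.leviCivita p u) t)
        (velocity (𝓡 3) (maximalGeodesic g.leviCivita p u) t) := by
    intro t _
    rw [finrank_euclideanSpace_fin]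
    change _ ≤ g.ricci (γ t) (velocity (𝓡 3) γ t) (velocity (𝓡 3) γ t)
    rw [ricci_eq_of_kappa g hS hκ, kappa_velocity_eq g hg hf hsol hRic0 hS hw₀ hnull hκ hgeo t, hκ0,
      hspeed t]
    have := hCS (γ t)
    push_cast
    linarith
  have hk : 0 < C / 4 := by positivity
  have hle := length_mul_sqrt_le_pi_of_isMinimizingUpTo g hg hdim hc p u hu hk hℓpos hmin' hRic'
  have hs4 : Real.sqrt (C / 4) = Real.sqrt C / 2 := by
    rw [Real.sqrt_div' C (by norm_num : (0:ℝ) ≤ 4),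
      show Real.sqrt 4 = 2 by rw [show (4:ℝ) = 2 ^ 2 by norm_num, Real.sqrt_sq zero_le_two]]
  rw [hs4] at hle
  rw [le_div_iff₀ hsC]
  linarith

include hgradf hH hκ hσ in
/-- **`Σ₀ = {h = 0}` is compact** on a complete degenerate soliton with `S ≥ C > 0`
(closed, and inside a closed metric ball, compact by hypothesis).
[cite: MunteanuWang2016, Thm. 1.2] [cite: Myers1941, Thm. 1] -/
theorem isCompact_H_eq_zero (hlam : lam ≠ 0)
    (hcpl : ∀ (x : M) (r : ℝ≥0), IsCompact {y : M | g.edist hg x y ≤ r})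
    {C : ℝ} (hC : 0 < C) (hCS : ∀ x, C ≤ g.scalarCurvature x) : IsCompact {x : M | H x = 0} := by
  haveI := contMDiffCovariantDerivative_leviCivita_one g
  have hc : IsGeodesicallyComplete g.leviCivita :=
    isGeodesicallyComplete_of_isCompact_closedBall hg hcpl
  obtain ⟨p, hp, -⟩ := exists_H_eq_zero_scalarCurvature_eq g hg hf hsol hRic0 hS hw₀ hnull hgradf hH
    hκ hσ hlam hc p₀
  have hclosed : IsClosed {x : M | H x = 0} :=
    isClosed_eq (continuous_H g hg hf hsol hRic0 hS hw₀ hnull hgradf hH) continuous_const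
  refine (hcpl p (Real.toNNReal (2 * Real.pi / Real.sqrt C))).of_isClosed_subset hclosed ?_
  intro q hq
  exact edist_le_of_H_eq_zero g hg hf hsol hRic0 hS hw₀ hnull hgradf hH hκ hσ hlam hc hC hCS hp hq

include hgradf hH hκ hσ in
/-- **`S` attains its infimum and its supremum over `M` at points of `Σ₀`.**
[cite: MunteanuWang2016, Thm. 1.2] -/
theorem exists_min_max_on_H_eq_zero (hlam : lam ≠ 0)
    (hcpl : ∀ (x : M) (r : ℝ≥0), IsCompact {y : M | g.edist hg x y ≤ r})
    {C : ℝ} (hC : 0 < C) (hCS : ∀ x, C ≤ g.scalarCurvature x) :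
    (∃ p : M, H p = 0 ∧ ∀ x, g.scalarCurvature p ≤ g.scalarCurvature x) ∧
    (∃ p : M, H p = 0 ∧ ∀ x, g.scalarCurvature x ≤ g.scalarCurvature p) := by
  haveI := contMDiffCovariantDerivative_leviCivita_one g
  have hc : IsGeodesicallyComplete g.leviCivita :=
    isGeodesicallyComplete_of_isCompact_closedBall hg hcpl
  have hK := isCompact_H_eq_zero g hg hf hsol hRic0 hS hw₀ hnull hgradf hH hκ hσ hlam hcpl hC hCS
  have htr := exists_H_eq_zero_scalarCurvature_eq g hg hf hsol hRic0 hS hw₀ hnull hgradf hH hκ hσ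
    hlam hc
  obtain ⟨p, hp, -⟩ := htr p₀
  have hne : ({x : M | H x = 0}).Nonempty := ⟨p, hp⟩
  have hcont : ContinuousOn g.scalarCurvature {x : M | H x = 0} :=
    g.contMDiff_scalarCurvature.continuous.continuousOn
  obtain ⟨pm, hpm, hmin⟩ := hK.exists_isMinOn hne hcont
  obtain ⟨pM, hpM, hmax⟩ := hK.exists_isMaxOn hne hcont
  refine ⟨⟨pm, hpm, fun x ↦ ?_⟩, ⟨pM, hpM, fun x ↦ ?_⟩⟩
  · obtain ⟨y, hy, hyx⟩ := htr x
    rw [← hyx]; exact hmin hy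
  · obtain ⟨y, hy, hyx⟩ := htr x
    rw [← hyx]; exact hmax hy

/-! ### Extrema of `S` on `Σ₀` are critical points of `f` -/

omit [T2Space M] in
include hgradf in
/-- **`dS(w) = 2 Ric(∇f, w)`** pointwise (the soliton identity, read in a chart).
[cite: PetersenWylie2010, §2] -/
theorem mvfderiv_scalarCurvature_apply (x : M) (w : TangentSpace (𝓡 3) x) :
    mvfderiv (𝓡 3) g.scalarCurvature x w = 2 * g.ricci x (gradf x) w := by
  obtain ⟨hGm, -, hfcs, hsolc, -⟩ := exists_chart_data g hg hf hsol hRic0 hS hw₀ hnull x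
  have hxs : x ∈ (extChartAt (𝓡 3) x).source := mem_extChartAt_source x
  have huT : extChartAt (𝓡 3) x x ∈ (extChartAt (𝓡 3) x).target := mem_extChartAt_target x
  obtain ⟨-, -, -, d4, -⟩ := dictionary_source g x hxs g.contMDiff_scalarCurvature w w
  obtain ⟨-, -, -, -, d5, -⟩ := dictionary_source g x hxs hf w w
  rw [d4, hgradf, d5, ← hGm.fderiv_scalAt_of_soliton huT hfcs hsolc]
  -- `S ∘ φ⁻¹ = scalAt G` near `φ x`
  refine congrFun (congrArg _ (Filter.EventuallyEq.fderiv_eq ?_)) _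
  filter_upwards [(isOpen_extChartAt_target (I := 𝓡 3) x).mem_nhds huT] with y hy
  exact Lorentzian.scalarCurvature_chartInv_eq g x ⟨y, hy⟩

omit [T2Space M] in
include hgradf hH in
/-- **At an extremum of `S` lying on `Σ₀`, `f` is critical**: `dS = 2Ric(∇f, ·) = 0` there, so
`|∇f|² = h + (2/S) Ric(∇f, ∇f) = 0` and `df = 0`. [cite: MunteanuWang2016, Thm. 1.2] -/
theorem gradSq_eq_zero_of_isExtr {p : M} (hp : H p = 0)
    (hext : IsMinOn g.scalarCurvature univ p ∨ IsMaxOn g.scalarCurvature univ p) :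
    g.gradSq f p = 0 ∧ mvfderiv (𝓡 3) f p = 0 := by
  have hdS : mvfderiv (𝓡 3) g.scalarCurvature p = 0 := by
    rcases hext with h | h
    · exact mvfderiv_eq_zero_of_isLocalMin (h.isLocalMin univ_mem)
    · exact mvfderiv_eq_zero_of_isLocalMax (h.isLocalMax univ_mem)
  have hRic : g.ricci p (gradf p) (gradf p) = 0 := by
    have h := mvfderiv_scalarCurvature_apply g hg hf hsol hRic0 hS hw₀ hnull hgradf p (gradf p)
    rw [hdS] at h
    have h' : (0 : ℝ) = 2 * g.ricci p (gradf p) (gradf p) := by simpa using h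
    linarith
  have hgrad : g.gradSq f p = 0 := by
    have h := hH p
    rw [hp, hRic, mul_zero, sub_zero] at h
    exact h.symm
  exact ⟨hgrad, mvfderiv_eq_zero_of_gradSq_eq_zero g hg hf hgrad⟩

include hgradf hH hκ hσ in
/-- **Summary for the normalised shrinker** (`λ = ½`, `S + |∇f|² = f`, complete): there are points
`p_min, p_max ∈ Σ₀` at which `S` attains its infimum, resp. supremum, over `M`; both are critical
points of `f` with `f = S` and `S = C e^{f}` there (`S = C e^{f − h}` globally,
`ThreeShrinkerDegenerateScalarBound`).
[cite: MunteanuWang2016, Thm. 1.2] [cite: Hamilton1988, §10] -/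
theorem exists_critical_min_max (hlam : lam = 1 / 2)
    (hnorm : ∀ x : M, g.scalarCurvature x + g.gradSq f x = f x)
    (hcpl : ∀ (x : M) (r : ℝ≥0), IsCompact {y : M | g.edist hg x y ≤ r}) :
    ∃ C : ℝ, 0 < C ∧ (∀ x, g.scalarCurvature x = C * Real.exp (f x - H x)) ∧
    ∃ pmin pmax : M,
      (H pmin = 0 ∧ mvfderiv (𝓡 3) f pmin = 0 ∧ g.gradSq f pmin = 0 ∧
        f pmin = g.scalarCurvature pmin ∧
        ∀ x, g.scalarCurvature pmin ≤ g.scalarCurvature x) ∧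
      (H pmax = 0 ∧ mvfderiv (𝓡 3) f pmax = 0 ∧ g.gradSq f pmax = 0 ∧
        f pmax = g.scalarCurvature pmax ∧
        ∀ x, g.scalarCurvature x ≤ g.scalarCurvature pmax) := by
  subst hlam
  have hlam : (1 / 2 : ℝ) ≠ 0 := by norm_num
  obtain ⟨C, hC, hSC⟩ := scalarCurvature_eq_mul_exp_of_degenerate g hg hf hlam hsol hRic0 hS hw₀
    hnull
  have hCS : ∀ x, C ≤ g.scalarCurvature x := by
    intro x
    have hle := gradSq_sub_ricci_le_gradSq g hRic0 hS x (f := f)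
    have hexp : (1 : ℝ) ≤ Real.exp (f x -
        (g.gradSq f x - 2 / g.scalarCurvature x *
          g.ricci x (g.sharp x (mvfderiv (𝓡 3) f x : TangentSpace (𝓡 3) x →ₗ[ℝ] ℝ))
            (g.sharp x (mvfderiv (𝓡 3) f x : TangentSpace (𝓡 3) x →ₗ[ℝ] ℝ))) / (2 * (1 / 2))) := by
      rw [show (2 : ℝ) * (1 / 2) = 1 by norm_num, div_one]
      refine Real.one_le_exp ?_
      have := hnorm x
      have := (hS x).le
      linarith
    calc C = C * 1 := (mul_one C).symm
      _ ≤ C * Real.exp _ := mul_le_mul_of_nonneg_left hexp hC.le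
      _ = g.scalarCurvature x := (hSC x).symm
  obtain ⟨⟨pm, hpm, hmin⟩, ⟨pM, hpM, hmax⟩⟩ := exists_min_max_on_H_eq_zero g hg hf hsol hRic0 hS hw₀
    hnull hgradf hH hκ hσ hlam hcpl hC hCS
  obtain ⟨hg1, hd1⟩ := gradSq_eq_zero_of_isExtr g hg hf hsol hRic0 hS hw₀ hnull hgradf hH hpm
    (Or.inl fun x _ ↦ hmin x)
  obtain ⟨hg2, hd2⟩ := gradSq_eq_zero_of_isExtr g hg hf hsol hRic0 hS hw₀ hnull hgradf hH hpM
    (Or.inr fun x _ ↦ hmax x)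
  refine ⟨C, hC, fun x ↦ ?_, pm, pM, ⟨hpm, hd1, hg1, ?_, hmin⟩, ⟨hpM, hd2, hg2, ?_, hmax⟩⟩
  · rw [hSC x, hH, hgradf, show (2 : ℝ) * (1 / 2) = 1 by norm_num, div_one]
  · have := hnorm pm; rw [hg1, add_zero] at this; exact this.symm
  · have := hnorm pM; rw [hg2, add_zero] at this; exact this.symm

end Along

end DegenerateShrinker

end Literature.Geometry.Riemannian

end
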